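import Summits.NavierStokesRegularity.OSWSelfSimilar.SheetREvansOdd
import HarnessLib

/-!
# SHEET-ℝ frame, Z3-SR-SPEC S2: the A-POSTERIORI ENCLOSURE of the Evans function on the odd class — `|E(σ) − (1 − θℓ(ũ))| ≤ |θ|‖ℓ‖‖f − g‖/(m + Re σ)`
# for ANY approximant `ũ` whose exact weak image `(A + σ)ũ = g` is known

HONEST FRAMING (cell ns-blowup GROUP B / zone Z3, case Z3-SR-SPEC, step (S2)(b) «at points `σ_k`, certified … values from forward solves … each a
float Galerkin solve + an a-posteriori enclosure `‖u − ũ‖ ≤ ‖residual‖/c`»; 1-D MODEL certificate frame (viscous gCLM/OSW sheet on the line); not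
Euler/NS; «violates: none — MODEL»). Nothing here is interval arithmetic and nothing asserts a profile or a zero exists; the Gårding datum (S1) is
the HYPOTHESIS `GardingDataKC`; `K`, `f ∈ Wcodd L`, `ℓ ∈ (Wcodd L)*`, `θ` are arbitrary.

This is the kernel sentence that turns a COMPUTED approximant into a certified enclosure of `E(σ) = 1 − θℓ(R_K(σ)f)` (`SheetREvansOdd.evansOdd`),
i.e. the bridge from implementation data to the hypothesis `RectLabelCertificate (evansOdd …)` of `SheetRSpectrumOddAssembly`:

* `resolventOdd_sub_of_mem_domain` — for `ũ ∈ D(T)`: `R_K(σ)f − ũ = R_K(σ)(f − (σ − T)ũ)` (`T = generatorOdd`, `(σ − T) = (A + σ)` weakly);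
* **`evansOdd_enclosure`** — `‖E(σ) − (1 − θ·ℓ ũ)‖ ≤ ‖θ‖·‖ℓ‖·‖f − (σũ − Tũ)‖/(m + Re σ)` (`Re σ > −m`), by the sharp pivot bound
  `norm_resolventOdd_le_inv`;
* **`evansOdd_enclosure_weak`** — the same with the residual in WEAK language: if `ũ ∈ L²_{w,odd}(ℂ)` has energy-space coordinates `P̃` and
  `A ũ = g − σũ` weakly (`IsWeakImage hL K d V P̃ (g − σũ)`, i.e. `(A + σ)ũ = g` — for a trigonometric Galerkin approximant `g` is exact frame algebra),
  then `‖E(σ) − (1 − θ·ℓ ũ)‖ ≤ ‖θ‖·‖ℓ‖·‖f − g‖/(m + Re σ)`.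
Pure functional analysis; no definition, no named fact.  WHAT THIS IS NOT: not NS; not the certificate; no number of record moves.
-/

noncomputable section

namespace Summit.NavierStokesRegularity.OSWSelfSimilar
namespace SheetREvansEnclosure

open _root_.MeasureTheory _root_.Set _root_.Filter _root_.Real SheetRWeakProfilePV SheetRWeakToStrong SheetREnergyClass SheetRWeightedMeasure
  SheetRLinearisedTests SheetREnergySpace SheetRTestSpace SheetRLinearisedFormBounds SheetRSolutionOperator SheetRLinearisedCutoffEnergy
  SheetRResolventPair SheetRComplexPivot SheetRResolventComplex SheetRResolventIdentity SheetRPerturbedUniqueness SheetRPerturbedPair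
  SheetRPerturbedResolventC SheetRPerturbedResolventIdentityC SheetROddClass SheetRResolventOddClass SheetRGeneratorOddWeak SheetREvansOdd
  Literature.Analysis.OperatorTheory
open scoped Topology ENNReal

variable {L D₀ D₁ V₀ c m : ℝ} {d V : ℝ → ℝ}

/-- **Residual identity**: for `ũ ∈ D(T)` and `Re σ > −m`, `R_K(σ)f − ũ = R_K(σ)(f − (σũ − Tũ))`. [folklore] -/
theorem resolventOdd_sub_of_mem_domain (hL : 0 < L) (K : Esp L hL →L[ℝ] W L) (h : GardingDataKC L hL d V K D₀ D₁ V₀ c m) {σ₀ σ : ℂ}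
    (hσ₀ : -m < σ₀.re) (hσ : -m < σ.re) (f : Wcodd L) {u : Wcodd L} (hu : u ∈ (generatorOdd hL K h σ₀ hσ₀).domain) :
    resolventOdd hL K h σ f - u = resolventOdd hL K h σ (f - (σ • u - generatorOdd hL K h σ₀ hσ₀ ⟨u, hu⟩)) := by
  rw [map_sub, resolventOdd_generatorOdd hL K h hσ₀ hσ hu]

/-- **A-posteriori enclosure of the Evans function** (operator language): for any `ũ ∈ D(T)`,
`‖E(σ) − (1 − θ·ℓ ũ)‖ ≤ ‖θ‖·‖ℓ‖·‖f − (σũ − Tũ)‖/(m + Re σ)`. [folklore] -/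
theorem evansOdd_enclosure (hL : 0 < L) (K : Esp L hL →L[ℝ] W L) (h : GardingDataKC L hL d V K D₀ D₁ V₀ c m) {σ₀ σ : ℂ}
    (hσ₀ : -m < σ₀.re) (hσ : -m < σ.re) (ℓ : Wcodd L →L[ℂ] ℂ) (f : Wcodd L) (θ : ℂ) {u : Wcodd L}
    (hu : u ∈ (generatorOdd hL K h σ₀ hσ₀).domain) :
    ‖evansOdd hL K h ℓ f θ σ - (1 - θ * ℓ u)‖ ≤
      ‖θ‖ * ‖ℓ‖ * ‖f - (σ • u - generatorOdd hL K h σ₀ hσ₀ ⟨u, hu⟩)‖ / (m + σ.re) := by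
  have hc : 0 < m + σ.re := by linarith
  set r : Wcodd L := f - (σ • u - generatorOdd hL K h σ₀ hσ₀ ⟨u, hu⟩) with hr
  have hres : resolventOdd hL K h σ f = u + resolventOdd hL K h σ r := by
    rw [hr, ← resolventOdd_sub_of_mem_domain hL K h hσ₀ hσ f hu]
    abel
  have hdiff : evansOdd hL K h ℓ f θ σ - (1 - θ * ℓ u) = -(θ * ℓ (resolventOdd hL K h σ r)) := by
    rw [evansOdd, hres, map_add]
    ring
  rw [hdiff, norm_neg, norm_mul]
  have hb := norm_resolventOdd_le_inv hL K h hσ r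
  have hℓ := ℓ.le_opNorm (resolventOdd hL K h σ r)
  calc ‖θ‖ * ‖ℓ (resolventOdd hL K h σ r)‖ ≤ ‖θ‖ * (‖ℓ‖ * (‖r‖ / (m + σ.re))) := by
        gcongr
        exact hℓ.trans (by gcongr)
    _ = ‖θ‖ * ‖ℓ‖ * ‖r‖ / (m + σ.re) := by ring

/-- **A-posteriori enclosure of the Evans function, WEAK language**: if `ũ ∈ L²_{w,odd}(ℂ)` has energy-space coordinates `P̃` and
`A ũ = g − σũ` weakly (`(A + σ)ũ = g`, `g ∈ L²_{w,odd}(ℂ)`), then `‖E(σ) − (1 − θ·ℓ ũ)‖ ≤ ‖θ‖·‖ℓ‖·‖f − g‖/(m + Re σ)`. [folklore] -/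
theorem evansOdd_enclosure_weak (hL : 0 < L) (K : Esp L hL →L[ℝ] W L) (h : GardingDataKC L hL d V K D₀ D₁ V₀ c m) {σ : ℂ}
    (hσ : -m < σ.re) (ℓ : Wcodd L →L[ℂ] ℂ) (f : Wcodd L) (θ : ℂ) {u g : Wcodd L} {P : WithLp 2 (Esp L hL × Esp L hL)}
    (hP : toPair L (u : Wc L) = ιpair hL P) (hw : IsWeakImage hL K d V P ((g : Wc L) - σ • (u : Wc L))) :
    ‖evansOdd hL K h ℓ f θ σ - (1 - θ * ℓ u)‖ ≤ ‖θ‖ * ‖ℓ‖ * ‖f - g‖ / (m + σ.re) := by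
  have hw' : IsWeakImage hL K d V P (((g - σ • u : Wcodd L)) : Wc L) := by rwa [Submodule.coe_sub, Submodule.coe_smul]
  obtain ⟨hu, hT⟩ := mem_domain_of_weak hL K h hσ hP hw'
  have hb := evansOdd_enclosure hL K h hσ hσ ℓ f θ hu
  have hg : σ • u - generatorOdd hL K h σ hσ ⟨u, hu⟩ = g := by rw [hT]; abel
  rwa [hg] at hb

/-! ### §2 (APPEND, selfsim g12) One resolvent step with an approximant, and the `L²_w`-functional form of `E` -/

/-- **One certified resolvent step** (operator language): for `ũ ∈ D(T)`, `‖R_K(σ)φ − ũ‖ ≤ ‖φ − (σũ − Tũ)‖/(m + Re σ)` — the enclosure of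
EVERY forward solve `u_{j+1} = R_K(σ)u_j` of the Taylor-model step from the exact residual of its approximant. [folklore] -/
theorem norm_resolventOdd_sub_le (hL : 0 < L) (K : Esp L hL →L[ℝ] W L) (h : GardingDataKC L hL d V K D₀ D₁ V₀ c m) {σ₀ σ : ℂ}
    (hσ₀ : -m < σ₀.re) (hσ : -m < σ.re) (φ : Wcodd L) {u : Wcodd L} (hu : u ∈ (generatorOdd hL K h σ₀ hσ₀).domain) :
    ‖resolventOdd hL K h σ φ - u‖ ≤ ‖φ - (σ • u - generatorOdd hL K h σ₀ hσ₀ ⟨u, hu⟩)‖ / (m + σ.re) := by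
  rw [resolventOdd_sub_of_mem_domain hL K h hσ₀ hσ φ hu]
  exact norm_resolventOdd_le_inv hL K h hσ _

/-- **One certified resolvent step, WEAK language**: if `ũ ∈ L²_{w,odd}(ℂ)` has energy-space coordinates `P̃` and `(A + σ)ũ = g` weakly
(`IsWeakImage hL K d V P̃ (g − σũ)`), then `‖R_K(σ)φ − ũ‖ ≤ ‖φ − g‖/(m + Re σ)` for every datum `φ`. [folklore] -/
theorem norm_resolventOdd_sub_le_weak (hL : 0 < L) (K : Esp L hL →L[ℝ] W L) (h : GardingDataKC L hL d V K D₀ D₁ V₀ c m) {σ : ℂ}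
    (hσ : -m < σ.re) (φ : Wcodd L) {u g : Wcodd L} {P : WithLp 2 (Esp L hL × Esp L hL)} (hP : toPair L (u : Wc L) = ιpair hL P)
    (hw : IsWeakImage hL K d V P ((g : Wc L) - σ • (u : Wc L))) :
    ‖resolventOdd hL K h σ φ - u‖ ≤ ‖φ - g‖ / (m + σ.re) := by
  have hw' : IsWeakImage hL K d V P (((g - σ • u : Wcodd L)) : Wc L) := by rwa [Submodule.coe_sub, Submodule.coe_smul]
  obtain ⟨hu, hT⟩ := mem_domain_of_weak hL K h hσ hP hw'
  have hb := norm_resolventOdd_sub_le hL K h hσ hσ φ hu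
  have hg : σ • u - generatorOdd hL K h σ hσ ⟨u, hu⟩ = g := by rw [hT]; abel
  rwa [hg] at hb

/-- **`E` with an `L²_w(ℂ)`-functional**: for `ℓ' : Wc L →L[ℂ] ℂ` restricted to the odd class, `evansOdd` unfolds through `resolventKC` — the form
on which `SheetREvansTaylorModel` (cert-5, keyed on `resolventKC`) is stated. [folklore] -/
theorem evansOdd_comp_subtypeL (hL : 0 < L) (K : Esp L hL →L[ℝ] W L) (h : GardingDataKC L hL d V K D₀ D₁ V₀ c m) (ℓ' : Wc L →L[ℂ] ℂ)
    (f : Wcodd L) (θ σ : ℂ) :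
    evansOdd hL K h (ℓ'.comp (Wcodd L).subtypeL) f θ σ = 1 - θ * ℓ' (resolventKC hL K h σ (f : Wc L)) := by
  rw [evansOdd, ContinuousLinearMap.comp_apply, Submodule.subtypeL_apply, coe_resolventOdd]

end SheetREvansEnclosure
end Summit.NavierStokesRegularity.OSWSelfSimilar

end
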